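import Summits.QuantumFields.BalabanUV.T4Continuum.Support.NE7GradientCurrencyCovariant
import Summits.QuantumFields.BalabanUV.T4Continuum.Support.NE7CovariantHodgeBond
import Summits.QuantumFields.BalabanUV.T4Continuum.Support.SkeletonPrecompTools
import Summits.QuantumFields.BalabanUV.T4Continuum.Support.MinimalActionClassSix
import HarnessLib

/-!
# NE7RelPlaqCodifferentialDock — THE RELATIVE-PLAQUETTE DATUM OF THE CURVED GRADIENT CURRENCY DOCKED TO [Balaban1985RegularSpaces] (1.2): the `W`-co-differential of
# `(W e^{Z})(∂p)·W(∂p)⁻¹ − 1` is within `d·K` of `covDiv 1 (W e^{Z}) − covDiv 1 W` (`B8Ineq132.covDiv`, gauge-invariant in norm), `K = 2(e^ρ−1)ε + 2εa + 2a²(2+a) + 2ε²(2+ε)`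
# — transport and inversion defects only, NO regularity spent; the curved twin of lineage #2's (158) `NE7GradientCurrencyCovariant.norm_plaqDivFlat_le_covDiv`; file 53

Cell `pub-balaban`, rung (B)+1 sub-cell t4, lineage `b2b-balaban-t4-ne7-p1` (CRUX PROVER NE7 #1 = OWNER of row NE7), generation 79; memo
`t4/b2b-balaban-t4-ne7-p1-g79/GRADIENT-LETTER.md` §2.  File F122 (over (158) `NE7GradientCurrencyCovariant` (`covDiv_one_eq_sum_ite`, `norm_inv_sub_inv_add_sub_le`,
`hol_plaqWord_swap'`), lit-balaban's `B8Ineq132` (`covDiv`, `plaqF`, `conjR`), F117 `NE7CovariantHodgeBond.norm_hol_plaqWord_sub_one_le`, `SkeletonPrecompTools.Ad_apply_one`, `NE3CovariantCalculus.cDstar`, `T4AveragingDeficitWall.vary`).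
WHY.  F121 `NE7GradientCurrencyCurved` bounds the gradient member of `Z` at the curved background `W` by `4(dρ∕R + R(J + P + …))`, `J` bounding the `W`-CO-DIFFERENTIAL
`Σ_μ ∇^†_{W,μ} Q_{μν}` of the relative plaquette deviation `Q_{μν} = (W e^{Z})(∂p_{μν})·W(∂p_{μν})⁻¹ − 1`.  The regularity datum a configuration of the class carries is the
gauge-COVARIANT flux divergence (1.2) `covDiv 1 U ν x = Σ_{μ<ν} ∇^†_{U,μ}F_{μν} − Σ_{μ>ν} ∇^†_{U,μ}F_{νμ}` (`F_{νμ} = F_{μν}⁻¹`).  Writing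
`Q = (S − 1) + (P⁻¹ − 1) + (S − 1)(P⁻¹ − 1)` (`S = (W e^{Z})(∂p)`, `P = W(∂p)`): the `S`-part under `∇^†_W` is `covDiv 1 (W e^{Z})` up to the transport defect
`Ad_{W(b)⁻¹} − Ad_{(W e^{Z})(b)⁻¹} = (1 − Ad_{e^{−Z(b)}})Ad_{W(b)⁻¹}` (`≤ 2(e^ρ−1)·ε`) and, for `μ > ν`, the inversion defect `(S−1) + (S⁻¹−1)` (`≤ ε²(2+ε)`); the `P⁻¹`-part
is EXACTLY `−covDiv 1 W` for `μ > ν` and up to the inversion defect `a²(2+a)` for `μ < ν`; the product costs `2εa`; `μ = ν` contributes nothing.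
WHAT ([folklore]; 0 def, 0 sorry).  §1 algebra (`MinimalActionClassSix.conjR_eq_Ad` BY NAME): the two regrouping identities `regroup_lt`, `regroup_gt`, the unit-inverse bookkeeping.  §2 **`norm_term_le`** (per
direction `μ`: `‖t_μ − c^{U′}_μ + c^{W}_μ‖ ≤ K`).  §3 THE END **`norm_codiff_relPlaq_le_covDiv`**: unitary `W` with `SmallField W a`, skew `Z` with `‖Z‖ ≤ ρ`,
`SmallField (vary W Z 1) ε` ⟹ `‖Σ_μ ∇^†_{W,μ} Q_{μν}(x)‖ ≤ ‖covDiv 1 (vary W Z 1) ν x‖ + ‖covDiv 1 W ν x‖ + d·K`.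
HONEST FRAMING (page 1): elementary lattice ∕ Banach-algebra analysis of OUR objects docked to lit-balaban's typed (1.2); the flux-divergence bounds themselves ((1.9) TYPE: class data
∕ R1+R2 material) remain HYPOTHESES downstream; nothing of Bałaban's asserted; NOT ONE-STEP, NOT NE7; spine 0∕9; finite T⁴ rung (B)+1 — NOT infinite volume, NOT mass gap, NOT
`BetaPertH`, NOT Clay.  Continuum YM on T⁴ ⇐ BetaPertH ∧ nine spine estimates (0/9 proved); BetaPertH ⇐ (D1) ∧ (D4) ∧ CAP+tail; G-an2-4 gates asym, D1 and NE2/3/4.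
-/

set_option autoImplicit false

open scoped BigOperators Matrix Matrix.Norms.L2Operator
open NormedSpace Finset

namespace Summit.QuantumFields.BalabanUV.T4Continuum.NE7RelPlaqCodifferentialDock

open Literature.MathematicalPhysics.QuantumFieldTheory.Balaban1983to89
open B7Prop1Explicit B7Prop2Explicit
open B7Eq78Linearization (conjR conjR_apply)
open B8Ineq132 (covDiv plaqF)
open T4AveragingDeficitWall (Ad IsUnitaryCfg IsSkewDir SmallField vary)
open T4AveragingDeficitNonAbelian (Ad_mul Ad_sub)
open AveragingDeficitTransport (norm_Ad_of_unitary mem_U1_of_unitary)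
open AveragingDeficitNearIdentity (Ad_one Ad_add norm_Ad_sub_le)
open SkeletonPrecompTools (Ad_apply_one)
open NE3CovariantCalculus (cDstar)
open NE7GradientCurrencyCovariant (covDiv_one_eq_sum_ite norm_inv_sub_inv_add_sub_le hol_plaqWord_swap')
open MinimalActionClassSix (conjR_eq_Ad)

noncomputable section

variable {d : ℕ} {n : Type*} [Fintype n] [DecidableEq n]

/-! ## §1 Algebra -/

/-- The regrouping for `μ < ν`: `t − c^{U′} + c^{W}` = transport defect + products + `P`-inversion defects. [folklore] -/
theorem regroup_lt (A B : (Matrix n n ℂ)ˣ) (S S' P P' : Matrix n n ℂ) (Pi Pi' : Matrix n n ℂ) :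
    (Ad A (S' * Pi' - 1) - (S * Pi - 1)) - (Ad B S' - S) + (Ad A P' - P)
      = (Ad A (S' - 1) - Ad B (S' - 1)) + (Ad A ((S' - 1) * (Pi' - 1)) - (S - 1) * (Pi - 1))
        + (Ad A ((Pi' - 1) + (P' - 1)) - ((Pi - 1) + (P - 1))) := by
  simp only [mul_sub, sub_mul, one_mul, mul_one, Ad_sub, Ad_add, Ad_apply_one]
  abel

/-- The regrouping for `μ > ν`: `t − c^{U′} + c^{W}` = transport defect + `S`-inversion defects + products (the `P⁻¹`-part matches EXACTLY). [folklore] -/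
theorem regroup_gt (A B : (Matrix n n ℂ)ˣ) (S S' : Matrix n n ℂ) (Si Si' Pi Pi' : Matrix n n ℂ) :
    (Ad A (S' * Pi' - 1) - (S * Pi - 1)) - (-(Ad B Si' - Si)) + (-(Ad A Pi' - Pi))
      = (Ad A (S' - 1) - Ad B (S' - 1)) + (Ad B ((S' - 1) + (Si' - 1)) - ((S - 1) + (Si - 1)))
        + (Ad A ((S' - 1) * (Pi' - 1)) - (S - 1) * (Pi - 1)) := by
  simp only [mul_sub, sub_mul, one_mul, mul_one, Ad_sub, Ad_add, Ad_apply_one]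
  abel

/-- `‖(Q⁻¹ − 1) + (Q − 1)‖ ≤ c(2+c)·‖Q − 1‖` for a unit with `‖Q⁻¹ − 1‖ ≤ c` ((158)'s inversion defect at `Q′ = 1`). [folklore] -/
theorem norm_inv_add_sub_le [Nonempty n] {Q : (Matrix n n ℂ)ˣ} {c : ℝ} (hQ : ‖((Q⁻¹ : (Matrix n n ℂ)ˣ) : Matrix n n ℂ) - 1‖ ≤ c) :
    ‖((((Q⁻¹ : (Matrix n n ℂ)ˣ) : Matrix n n ℂ) - 1) + ((Q : Matrix n n ℂ) - 1))‖ ≤ c * (2 + c) * ‖(Q : Matrix n n ℂ) - 1‖ := by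
  have hc : 0 ≤ c := (norm_nonneg _).trans hQ
  have h1 : ‖(((1 : (Matrix n n ℂ)ˣ)⁻¹ : (Matrix n n ℂ)ˣ) : Matrix n n ℂ) - 1‖ ≤ c := by rw [inv_one, Units.val_one, sub_self, norm_zero]; exact hc
  have h := norm_inv_sub_inv_add_sub_le (Q := Q) (Q' := 1) hQ h1
  simpa only [inv_one, Units.val_one] using h

/-! ## §2 The per-direction bound -/

/-- **PER DIRECTION**: with `A = W(x−e_μ,μ)⁻¹`, `B = (W e^{Z})(x−e_μ,μ)⁻¹ = e^{−Z}A`, unitary data, `‖S−1‖,‖S′−1‖,‖S⁻¹−1‖,‖S′⁻¹−1‖ ≤ ε`, `‖P−1‖,…,‖P′⁻¹−1‖ ≤ a`,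
`‖e^{−Z} − 1‖ ≤ e^ρ − 1`: both regrouped expressions are within `K = 2(e^ρ−1)ε + 2εa + 2a²(2+a) + 2ε²(2+ε)`. [folklore] -/
theorem norm_regroup_le [Nonempty n] {A E : (Matrix n n ℂ)ˣ} (hA : A ∈ unitaryUnits (Matrix n n ℂ)) (hE : E ∈ unitaryUnits (Matrix n n ℂ))
    {S S' P P' : (Matrix n n ℂ)ˣ} {ε a r : ℝ}
    (hS : ‖(S : Matrix n n ℂ) - 1‖ ≤ ε) (hS' : ‖(S' : Matrix n n ℂ) - 1‖ ≤ ε)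
    (hSi : ‖((S⁻¹ : (Matrix n n ℂ)ˣ) : Matrix n n ℂ) - 1‖ ≤ ε) (hSi' : ‖((S'⁻¹ : (Matrix n n ℂ)ˣ) : Matrix n n ℂ) - 1‖ ≤ ε)
    (hP : ‖(P : Matrix n n ℂ) - 1‖ ≤ a) (hP' : ‖(P' : Matrix n n ℂ) - 1‖ ≤ a)
    (hPi : ‖((P⁻¹ : (Matrix n n ℂ)ˣ) : Matrix n n ℂ) - 1‖ ≤ a) (hPi' : ‖((P'⁻¹ : (Matrix n n ℂ)ˣ) : Matrix n n ℂ) - 1‖ ≤ a)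
    (hEr : ‖(E : Matrix n n ℂ) - 1‖ ≤ r) :
    ‖(Ad A ((S' : Matrix n n ℂ) - 1) - Ad (E * A) ((S' : Matrix n n ℂ) - 1))
        + (Ad A (((S' : Matrix n n ℂ) - 1) * (((P'⁻¹ : (Matrix n n ℂ)ˣ) : Matrix n n ℂ) - 1))
            - ((S : Matrix n n ℂ) - 1) * (((P⁻¹ : (Matrix n n ℂ)ˣ) : Matrix n n ℂ) - 1))
        + (Ad A ((((P'⁻¹ : (Matrix n n ℂ)ˣ) : Matrix n n ℂ) - 1) + ((P' : Matrix n n ℂ) - 1))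
            - ((((P⁻¹ : (Matrix n n ℂ)ˣ) : Matrix n n ℂ) - 1) + ((P : Matrix n n ℂ) - 1)))‖
      ≤ 2 * r * ε + 2 * (ε * a) + 2 * (a * (2 + a) * a) ∧
    ‖(Ad A ((S' : Matrix n n ℂ) - 1) - Ad (E * A) ((S' : Matrix n n ℂ) - 1))
        + (Ad (E * A) (((S' : Matrix n n ℂ) - 1) + (((S'⁻¹ : (Matrix n n ℂ)ˣ) : Matrix n n ℂ) - 1))
            - (((S : Matrix n n ℂ) - 1) + (((S⁻¹ : (Matrix n n ℂ)ˣ) : Matrix n n ℂ) - 1)))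
        + (Ad A (((S' : Matrix n n ℂ) - 1) * (((P'⁻¹ : (Matrix n n ℂ)ˣ) : Matrix n n ℂ) - 1))
            - ((S : Matrix n n ℂ) - 1) * (((P⁻¹ : (Matrix n n ℂ)ˣ) : Matrix n n ℂ) - 1))‖
      ≤ 2 * r * ε + 2 * (ε * (2 + ε) * ε) + 2 * (ε * a) := by
  have hε : 0 ≤ ε := (norm_nonneg _).trans hS
  have ha : 0 ≤ a := (norm_nonneg _).trans hP
  have hr : 0 ≤ r := (norm_nonneg _).trans hEr
  -- the transport defect
  have htr : ‖Ad A ((S' : Matrix n n ℂ) - 1) - Ad (E * A) ((S' : Matrix n n ℂ) - 1)‖ ≤ 2 * r * ε := by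
    rw [Ad_mul, ← norm_neg, neg_sub]
    refine (norm_Ad_sub_le hE _).trans ?_
    rw [norm_Ad_of_unitary hA]
    gcongr
  -- the products
  have hprod : ‖Ad A (((S' : Matrix n n ℂ) - 1) * (((P'⁻¹ : (Matrix n n ℂ)ˣ) : Matrix n n ℂ) - 1))
      - ((S : Matrix n n ℂ) - 1) * (((P⁻¹ : (Matrix n n ℂ)ˣ) : Matrix n n ℂ) - 1)‖ ≤ 2 * (ε * a) := by
    refine (norm_sub_le _ _).trans ?_
    rw [norm_Ad_of_unitary hA]
    have h1 := (norm_mul_le ((S' : Matrix n n ℂ) - 1) _).trans (mul_le_mul hS' hPi' (norm_nonneg _) hε)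
    have h2 := (norm_mul_le ((S : Matrix n n ℂ) - 1) _).trans (mul_le_mul hS hPi (norm_nonneg _) hε)
    linarith
  -- the inversion defects
  have hinvP : ‖Ad A ((((P'⁻¹ : (Matrix n n ℂ)ˣ) : Matrix n n ℂ) - 1) + ((P' : Matrix n n ℂ) - 1))
      - ((((P⁻¹ : (Matrix n n ℂ)ˣ) : Matrix n n ℂ) - 1) + ((P : Matrix n n ℂ) - 1))‖ ≤ 2 * (a * (2 + a) * a) := by
    refine (norm_sub_le _ _).trans ?_
    rw [norm_Ad_of_unitary hA]
    have h1 := (norm_inv_add_sub_le hPi').trans (mul_le_mul_of_nonneg_left hP' (by positivity))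
    have h2 := (norm_inv_add_sub_le hPi).trans (mul_le_mul_of_nonneg_left hP (by positivity))
    linarith
  have hinvS : ‖Ad (E * A) (((S' : Matrix n n ℂ) - 1) + (((S'⁻¹ : (Matrix n n ℂ)ˣ) : Matrix n n ℂ) - 1))
      - (((S : Matrix n n ℂ) - 1) + (((S⁻¹ : (Matrix n n ℂ)ˣ) : Matrix n n ℂ) - 1))‖ ≤ 2 * (ε * (2 + ε) * ε) := by
    refine (norm_sub_le _ _).trans ?_
    rw [norm_Ad_of_unitary ((unitaryUnits _).mul_mem hE hA)]
    have h1 := (norm_inv_add_sub_le hSi').trans (mul_le_mul_of_nonneg_left hS' (by positivity))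
    have h2 := (norm_inv_add_sub_le hSi).trans (mul_le_mul_of_nonneg_left hS (by positivity))
    rw [add_comm (((S' : Matrix n n ℂ)) - 1), add_comm (((S : Matrix n n ℂ)) - 1)]
    linarith
  constructor
  · exact (norm_add_le _ _).trans (add_le_add ((norm_add_le _ _).trans (add_le_add htr hprod)) hinvP)
  · exact (norm_add_le _ _).trans (add_le_add ((norm_add_le _ _).trans (add_le_add htr hinvS)) hprod)

/-! ## §3 THE END: the co-differential of the relative plaquette deviation against (1.2) -/

/-- **THE RELATIVE-PLAQUETTE DATUM DOCKED TO (1.2).**  For unitary `W` with `SmallField W a`, a skew `Z` with `‖Z‖ ≤ ρ`, and `SmallField (vary W Z 1) ε` (the plaquette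
radius of `U′ = W e^{Z}`): at every site `x` and component `ν`,
`‖Σ_μ ∇^†_{W,μ}[(W e^{Z})(∂p_{μν})·W(∂p_{μν})⁻¹ − 1](x)‖ ≤ ‖covDiv 1 (vary W Z 1) ν x‖ + ‖covDiv 1 W ν x‖ + d·(2(e^ρ−1)ε + 2εa + 2a²(2+a) + 2ε²(2+ε))`. [folklore] -/
theorem norm_codiff_relPlaq_le_covDiv [Nonempty n] {W : Site d → Fin d → (Matrix n n ℂ)ˣ} (hW : IsUnitaryCfg W) {a : ℝ} (ha : 0 ≤ a) (hWa : SmallField W a)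
    {Z : Site d → Fin d → Matrix n n ℂ} (hZs : IsSkewDir Z) {ρ : ℝ} (hZ : ∀ y κ, ‖Z y κ‖ ≤ ρ)
    {ε : ℝ} (hε : 0 ≤ ε) (hUε : SmallField (vary W Z 1) ε) (x : Site d) (ν : Fin d) :
    ‖∑ μ, cDstar W μ (fun y => ((hol (vary W Z 1) y (plaqWord μ ν) : (Matrix n n ℂ)ˣ) : Matrix n n ℂ)
        * (((hol W y (plaqWord μ ν))⁻¹ : (Matrix n n ℂ)ˣ) : Matrix n n ℂ) - 1) x‖
      ≤ ‖covDiv 1 (vary W Z 1) ν x‖ + ‖covDiv 1 W ν x‖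
        + d * (2 * (Real.exp ρ - 1) * ε + 2 * (ε * a) + 2 * (a * (2 + a) * a) + 2 * (ε * (2 + ε) * ε)) := by
  classical
  letI : NormedAlgebra ℚ (Matrix n n ℂ) := NormedAlgebra.restrictScalars ℚ ℝ (Matrix n n ℂ)
  set U' := vary W Z 1 with hU'
  -- unitarity of `U′ = W e^{Z}` and of the exponential factors
  have hEu : ∀ (y : Site d) (κ : Fin d), expUnit (((1 : ℝ) : ℂ) • Z y κ) ∈ unitaryUnits (Matrix n n ℂ) := fun y κ => by
    rw [mem_unitaryUnits, val_expUnit, Complex.ofReal_one, one_smul]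
    exact NormedSpace.exp_mem_unitary_of_mem_skewAdjoint (hZs y κ)
  have hU'u : IsUnitaryCfg U' := fun y κ => (unitaryUnits _).mul_mem (hW y κ) (hEu y κ)
  -- the plaquette data
  have hPa : ∀ (y : Site d) (μ : Fin d), ‖((hol W y (plaqWord μ ν) : (Matrix n n ℂ)ˣ) : Matrix n n ℂ) - 1‖ ≤ a :=
    fun y μ => NE7CovariantHodgeBond.norm_hol_plaqWord_sub_one_le ha hWa y μ ν
  have hSε : ∀ (y : Site d) (μ : Fin d), ‖((hol U' y (plaqWord μ ν) : (Matrix n n ℂ)ˣ) : Matrix n n ℂ) - 1‖ ≤ ε :=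
    fun y μ => NE7CovariantHodgeBond.norm_hol_plaqWord_sub_one_le hε hUε y μ ν
  have hinv : ∀ {Q : (Matrix n n ℂ)ˣ} {c : ℝ}, Q ∈ unitaryUnits (Matrix n n ℂ) → ‖(Q : Matrix n n ℂ) - 1‖ ≤ c →
      ‖((Q⁻¹ : (Matrix n n ℂ)ˣ) : Matrix n n ℂ) - 1‖ ≤ c := fun hQ hc => (norm_inv_sub_one_le (mem_U1_of_unitary hQ)).trans hc
  -- the reference sums (1.2) for `U′` and `W`
  set cU : Fin d → Matrix n n ℂ := fun μ =>
    if μ < ν then conjR (U' (x - e μ) μ)⁻¹ (plaqF U' μ ν (x - e μ)) - plaqF U' μ ν x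
      else if ν < μ then -(conjR (U' (x - e μ) μ)⁻¹ (plaqF U' ν μ (x - e μ)) - plaqF U' ν μ x) else 0 with hcU
  set cW : Fin d → Matrix n n ℂ := fun μ =>
    if μ < ν then conjR (W (x - e μ) μ)⁻¹ (plaqF W μ ν (x - e μ)) - plaqF W μ ν x
      else if ν < μ then -(conjR (W (x - e μ) μ)⁻¹ (plaqF W ν μ (x - e μ)) - plaqF W ν μ x) else 0 with hcW
  have hsumU : covDiv 1 U' ν x = ∑ μ, cU μ := covDiv_one_eq_sum_ite U' ν x
  have hsumW : covDiv 1 W ν x = ∑ μ, cW μ := covDiv_one_eq_sum_ite W ν x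
  set t : Fin d → Matrix n n ℂ := fun μ => cDstar W μ (fun y => ((hol U' y (plaqWord μ ν) : (Matrix n n ℂ)ˣ) : Matrix n n ℂ)
        * (((hol W y (plaqWord μ ν))⁻¹ : (Matrix n n ℂ)ˣ) : Matrix n n ℂ) - 1) x with ht
  -- the constant
  set K : ℝ := 2 * (Real.exp ρ - 1) * ε + 2 * (ε * a) + 2 * (a * (2 + a) * a) + 2 * (ε * (2 + ε) * ε) with hK
  have hρ0 : 0 ≤ ρ := (norm_nonneg _).trans (hZ x ν)
  have hr0 : 0 ≤ Real.exp ρ - 1 := by have := Real.one_le_exp hρ0; linarith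
  have hK0 : 0 ≤ K := by positivity
  -- per direction
  have hterm : ∀ μ : Fin d, ‖t μ - cU μ + cW μ‖ ≤ K := by
    intro μ
    -- the units at play
    have hA : (W (x - e μ) μ)⁻¹ ∈ unitaryUnits (Matrix n n ℂ) := (unitaryUnits _).inv_mem (hW _ _)
    have hE : (expUnit (((1 : ℝ) : ℂ) • Z (x - e μ) μ))⁻¹ ∈ unitaryUnits (Matrix n n ℂ) := (unitaryUnits _).inv_mem (hEu _ _)
    have hEr : ‖(((expUnit (((1 : ℝ) : ℂ) • Z (x - e μ) μ))⁻¹ : (Matrix n n ℂ)ˣ) : Matrix n n ℂ) - 1‖ ≤ Real.exp ρ - 1 := by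
      rw [val_inv_expUnit, val_expUnit, Complex.ofReal_one, one_smul]
      refine (norm_exp_sub_one_le_of_norm_le (le_refl ‖-Z (x - e μ) μ‖)).1.trans ?_
      rw [norm_neg]
      exact sub_le_sub_right (Real.exp_le_exp.mpr (hZ _ _)) 1
    have hB : (U' (x - e μ) μ)⁻¹ = (expUnit (((1 : ℝ) : ℂ) • Z (x - e μ) μ))⁻¹ * (W (x - e μ) μ)⁻¹ := by
      rw [hU']; unfold vary; rw [mul_inv_rev]
    have hb := norm_regroup_le hA hE (hSε x μ) (hSε (x - e μ) μ) (hinv (hol_mem_of hU'u _ _) (hSε x μ)) (hinv (hol_mem_of hU'u _ _) (hSε (x - e μ) μ))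
      (hPa x μ) (hPa (x - e μ) μ) (hinv (hol_mem_of hW _ _) (hPa x μ)) (hinv (hol_mem_of hW _ _) (hPa (x - e μ) μ)) hEr
    rcases lt_trichotomy μ ν with hlt | heq | hgt
    · -- `μ < ν`
      have hcUμ : cU μ = Ad (U' (x - e μ) μ)⁻¹ ((hol U' (x - e μ) (plaqWord μ ν) : (Matrix n n ℂ)ˣ) : Matrix n n ℂ)
          - ((hol U' x (plaqWord μ ν) : (Matrix n n ℂ)ˣ) : Matrix n n ℂ) := by
        rw [hcU]; simp only [if_pos hlt, conjR_eq_Ad]; rfl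
      have hcWμ : cW μ = Ad (W (x - e μ) μ)⁻¹ ((hol W (x - e μ) (plaqWord μ ν) : (Matrix n n ℂ)ˣ) : Matrix n n ℂ)
          - ((hol W x (plaqWord μ ν) : (Matrix n n ℂ)ˣ) : Matrix n n ℂ) := by
        rw [hcW]; simp only [if_pos hlt, conjR_eq_Ad]; rfl
      rw [hcUμ, hcWμ, hB, ht]
      show ‖(Ad (W (x - e μ) μ)⁻¹ _ - _) - _ + _‖ ≤ K
      rw [regroup_lt]
      refine hb.1.trans ?_
      have h3 : 0 ≤ ε * (2 + ε) * ε := by positivity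
      rw [hK]; linarith
    · -- `μ = ν`: everything vanishes
      subst heq
      have hcUμ : cU μ = 0 := by rw [hcU]; simp only [lt_irrefl, if_false]
      have hcWμ : cW μ = 0 := by rw [hcW]; simp only [lt_irrefl, if_false]
      have htμ : t μ = 0 := by
        rw [ht]
        simp only [cDstar, hol_plaqWord_self, inv_one, Units.val_one, mul_one, sub_self, AveragingDeficitNearIdentity.Ad_zero]
      rw [htμ, hcUμ, hcWμ, sub_zero, add_zero, norm_zero]; exact hK0
    · -- `μ > ν`
      have hcUμ : cU μ = -(Ad (U' (x - e μ) μ)⁻¹ (((hol U' (x - e μ) (plaqWord μ ν))⁻¹ : (Matrix n n ℂ)ˣ) : Matrix n n ℂ)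
          - (((hol U' x (plaqWord μ ν))⁻¹ : (Matrix n n ℂ)ˣ) : Matrix n n ℂ)) := by
        rw [hcU]; simp only [if_neg (lt_asymm hgt), if_pos hgt, conjR_eq_Ad]
        show -(Ad _ (plaqF U' ν μ (x - e μ)) - plaqF U' ν μ x) = _
        unfold plaqF; rw [hol_plaqWord_swap' U' (x - e μ) μ ν, hol_plaqWord_swap' U' x μ ν]
      have hcWμ : cW μ = -(Ad (W (x - e μ) μ)⁻¹ (((hol W (x - e μ) (plaqWord μ ν))⁻¹ : (Matrix n n ℂ)ˣ) : Matrix n n ℂ)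
          - (((hol W x (plaqWord μ ν))⁻¹ : (Matrix n n ℂ)ˣ) : Matrix n n ℂ)) := by
        rw [hcW]; simp only [if_neg (lt_asymm hgt), if_pos hgt, conjR_eq_Ad]
        show -(Ad _ (plaqF W ν μ (x - e μ)) - plaqF W ν μ x) = _
        unfold plaqF; rw [hol_plaqWord_swap' W (x - e μ) μ ν, hol_plaqWord_swap' W x μ ν]
      rw [hcUμ, hcWμ, hB, ht]
      show ‖(Ad (W (x - e μ) μ)⁻¹ _ - _) - _ + _‖ ≤ K
      rw [regroup_gt]
      refine hb.2.trans ?_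
      have h3 : 0 ≤ a * (2 + a) * a := by positivity
      rw [hK]; linarith
  -- assemble: `Σ t = Σ (t − cU + cW) + covDiv U′ − covDiv W`
  have hsplit : ∑ μ, t μ = ∑ μ, (t μ - cU μ + cW μ) + covDiv 1 U' ν x - covDiv 1 W ν x := by
    rw [hsumU, hsumW, Finset.sum_add_distrib, Finset.sum_sub_distrib]; abel
  show ‖∑ μ, t μ‖ ≤ _
  rw [hsplit]
  have h1 : ‖∑ μ, (t μ - cU μ + cW μ)‖ ≤ d * K := by
    refine (norm_sum_le _ _).trans ?_
    calc ∑ μ, ‖t μ - cU μ + cW μ‖ ≤ ∑ _μ : Fin d, K := Finset.sum_le_sum fun μ _ => hterm μ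
      _ = d * K := by rw [Finset.sum_const, Finset.card_univ, Fintype.card_fin, nsmul_eq_mul]
  calc ‖∑ μ, (t μ - cU μ + cW μ) + covDiv 1 U' ν x - covDiv 1 W ν x‖
      ≤ ‖∑ μ, (t μ - cU μ + cW μ) + covDiv 1 U' ν x‖ + ‖covDiv 1 W ν x‖ := norm_sub_le _ _
    _ ≤ (d * K + ‖covDiv 1 U' ν x‖) + ‖covDiv 1 W ν x‖ := by gcongr; exact (norm_add_le _ _).trans (add_le_add h1 le_rfl)
    _ = _ := by rw [hK]; ring

end

end Summit.QuantumFields.BalabanUV.T4Continuum.NE7RelPlaqCodifferentialDock
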